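import Literature.NumberTheory.ConnesConsani2024.ProlateWaveCyclicPairs
import Literature.NumberTheory.ConnesConsani2024.ProlateWaveCyclicPairsJacobiProofs
import Literature.NumberTheory.LFunctions.MuentzFormulaSchwartz
import Literature.Analysis.FunctionSpaces.GaussianSchwartz
import Mathlib.Analysis.Fourier.PoissonSummation
import HarnessLib

/-!
# Connes–Consani–Moscovici 2024, §3.6 "Link with `ℰ` and zeta": Proposition 3.6 (i) — PROVED
# (discharge of the named fact `CCM2024_prop_3_6_i` of `ProlateWaveCyclicPairs.lean`)

LINE 1 — FRAMING: RH-FREE corpus literature (Mellin/Poisson bookkeeping for the functions `ψ^±_ℓ` of eq. (29);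
nothing here bears on the truth of RH); cell rh-crit, corpus C1, seat t12 (discharge flip of its own typing);
bears_on: W-C/W-P (sequel, no leaf role).  WHAT THIS IS NOT: any claim about RH, any new named fact — this file
declares NO definition and NO fact; it only PROVES `CCM2024_prop_3_6_i` (typed by seat t12, AS PRINTED).

Source: A. Connes, C. Consani, H. Moscovici, *Zeta zeros and prolate wave operators*, Ann. Funct. Anal. 15 (2024)
= arXiv:2310.18423v2 [bib: `ConnesConsaniMoscovici2024`] (held text `paper:arxiv-2310.18423`), §3.6 pp. 14–15
(chunks p0010:L14–L96, p0011:L1–L12): Prop. 3.6 (i) "`𝔽_μ(ℰ(ψ^±_ℓ))(s) = R^±_ℓ(s)·Ξ(s)`".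

## The printed argument and its formalisation

Printed (p. 15, p0011:L1–L5): by Lemma 3.3 (i) `𝔽_μ(w_∞ψ)(s) = L_∞(½ − is)·P(s)`; "`𝔽_μ ∘ ℰ = ζ(½ − is)·𝔽_μ ∘ w_∞`"
(the scaling map `ℰ = w_∞ ∘ Σ` multiplies Mellin transforms by `ζ`); and `P = −½(¼ + s²)R` together with
`Ξ(s) = z(z−1)/2·L_∞(z)ζ(z)`, `z = ½ + is` (eq. (35)) give `R·Ξ`.

* On the half-plane `Im s > −1/2`, `s ≠ i/2` (`mulHaarFourier_connesE_psiPlus/psiMinus`): Müntz's formula in the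
  critical strip for Schwartz data with `∫₀^∞ψ = 0` (tree: `LFunctions.MuentzFormulaSchwartz.mellin_connesE_schwartz`,
  Connes–Consani 2023 proof of Thm. 6.4) + `CCM2024_lemma_3_3_i` (tree, seat t12) + the `ξ` bookkeeping
  `ζ(w)L_∞(w)(−½(¼+s²)) = Ξ(s)`, `w = ½ − is` (`riemannXi_one_sub`).  The condition `∫₀^∞ ψ^±_ℓ = 0` IS
  `𝒰(ψ^±_ℓ)(i/2) = 0`, i.e. the second clause of Lemma 3.3 (i) (`integral_Ioi_psiPlus/psiMinus`); `ψ^±_ℓ` are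
  Schwartz as polynomial multiples of the Gaussian (`exists_schwartz_coe_eq_psiPlus/psiMinus`, over the tree's
  `Analysis.FunctionSpaces.realGaussianSchwartz`).
* On all of `ℂ` (`CCM2024_prop_3_6_i_holds`): both sides are ENTIRE and agree on an open set.  `R·Ξ` is entire
  (`differentiable_riemannXi`).  `𝔽_μ(ℰψ)(s) = ∫₀^∞ ℰψ(u)u^{−is}d*u` is entire because `ℰψ` decays rapidly at BOTH
  ends (`differentiable_mellin_connesE`, Mathlib `mellin_differentiableAt_of_isBigO_rpow`): at `∞` trivially
  (`connesE_schwartz_isBigO_atTop`), at `0⁺` by **Poisson summation** for the dilates `x ↦ ψ(xu)`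
  (`SchwartzMap.tsum_eq_tsum_fourier`): for even Schwartz `ψ` with `ψ(0) = 0 = ψ̂(0)`,
  `2Σ_{n≥1}ψ(nu) = u⁻¹Σ_{k≥1}(ψ̂(k/u) + ψ̂(−k/u)) = O(u^{M−1})` for every `M` (`two_mul_tsum_dilate_eq`,
  `norm_tsum_dilate_le_pow`, `connesE_schwartz_isBigO_nhdsGT_zero`).  This is the standard mechanism behind
  "`ℰ` maps `𝒮(ℝ)₀^{ev}` to functions whose Mellin transform is entire" implicit in §3.6 (and in Connes–Consani
  2021 §1, 2023 §6); it is not spelled out in the printed proof, which works with entire functions throughout.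

Also (appended): `CCM2024_eq_9_holds` — eq. (9) for even cyclic pairs, a one-line re-export of seat t16's
`CCM2024_eq_9_of_even` (`ProlateWaveCyclicPairsJacobiProofs.lean`, imported).

Main declarations (namespace `Literature.NumberTheory.ConnesConsani2024`): `mulHaarFourier_connesE_psiPlus`,
`mulHaarFourier_connesE_psiMinus` (half-plane), `differentiable_mellin_connesE` (general: `f ∈ 𝒮(ℝ,ℝ)` even,
`f(0) = 0`, `∫₀^∞ f = 0`), `CCM2024_prop_3_6_i_holds`.
-/

noncomputable section

namespace Literature.NumberTheory.ConnesConsani2024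

open _root_.MeasureTheory Complex Polynomial Filter Set Asymptotics
open scoped Real Topology Nat FourierTransform
open Literature.NumberTheory.LFunctions

/-- `Re(½ − is) = ½ + Im s`. [folklore] -/
private theorem re_w' (s : ℂ) : (1 / 2 - I * s).re = 1 / 2 + s.im := by
  simp


/-! ### Prop. 3.6 (i) on the half-plane `Im s > −1/2`: `𝔽_μ(ℰψ^±_ℓ) = R^±_ℓ·Ξ` -/

/-- `h_{2n}(x) = (Σ_k c_{n,k} x^{2k})·e^{−πx²}` (eq. (21) with the Gaussian factored out). [cite: ConnesConsaniMoscovici2024, Prop. 3.2 eq. (21) p. 11 (p0009:L5)] -/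
theorem evenHermiteFn_eq_sum_mul (n : ℕ) (x : ℝ) : evenHermiteFn n x =
    (∑ k ∈ Finset.range (n + 1), (-1 : ℝ) ^ (n - k) * ((2 : ℝ) ^ (1 / 4 : ℝ) * 2 ^ (3 * k) / 2 ^ n) *
      Real.sqrt ((2 * n)! : ℝ) / (((2 * k)! : ℝ) * ((n - k)! : ℝ)) * π ^ k * x ^ (2 * k)) *
      Real.exp (-π * x ^ 2) := by
  rw [evenHermiteFn, Finset.sum_mul]

/-- `ψ⁺_ℓ` is a real Schwartz function (a polynomial multiple of the Gaussian). [cite: ConnesConsaniMoscovici2024, §3.6 eq. (29) p. 14 (p0010:L25)] -/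
theorem exists_schwartz_coe_eq_psiPlus (ℓ : ℕ) : ∃ f : SchwartzMap ℝ ℝ, ⇑f = psiPlus ℓ := by
  set w : ℝ → ℝ := fun x => (∑ k ∈ Finset.range (2 * ℓ + 1), (-1 : ℝ) ^ (2 * ℓ - k) *
      ((2 : ℝ) ^ (1 / 4 : ℝ) * 2 ^ (3 * k) / 2 ^ (2 * ℓ)) * Real.sqrt ((2 * (2 * ℓ))! : ℝ) /
      (((2 * k)! : ℝ) * ((2 * ℓ - k)! : ℝ)) * π ^ k * x ^ (2 * k)) -
      evenHermiteFn (2 * ℓ) 0 / hermiteH0 0 * (2 : ℝ) ^ ((1 : ℝ) / 4) with hw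
  have hwg : Function.HasTemperateGrowth w := by
    rw [hw]
    fun_prop
  refine ⟨SchwartzMap.smulLeftCLM ℝ w (Literature.Analysis.FunctionSpaces.realGaussianSchwartz ℝ π), ?_⟩
  funext x
  rw [SchwartzMap.smulLeftCLM_apply_apply hwg,
    Literature.Analysis.FunctionSpaces.realGaussianSchwartz_apply Real.pi_pos, Real.norm_eq_abs, sq_abs,
    smul_eq_mul, psiPlus, evenHermiteFn_eq_sum_mul,
    show hermiteH0 x = (2 : ℝ) ^ ((1 : ℝ) / 4) * Real.exp (-π * x ^ 2) from rfl]
  simp only [hw]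
  ring

/-- `ψ⁻_ℓ` is a real Schwartz function. [cite: ConnesConsaniMoscovici2024, §3.6 eq. (29) p. 14 (p0010:L28)] -/
theorem exists_schwartz_coe_eq_psiMinus (ℓ : ℕ) : ∃ f : SchwartzMap ℝ ℝ, ⇑f = psiMinus ℓ := by
  set w : ℝ → ℝ := fun x => -(∑ k ∈ Finset.range (2 * ℓ + 1 + 1), (-1 : ℝ) ^ (2 * ℓ + 1 - k) *
      ((2 : ℝ) ^ (1 / 4 : ℝ) * 2 ^ (3 * k) / 2 ^ (2 * ℓ + 1)) * Real.sqrt ((2 * (2 * ℓ + 1))! : ℝ) /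
      (((2 * k)! : ℝ) * ((2 * ℓ + 1 - k)! : ℝ)) * π ^ k * x ^ (2 * k)) +
      evenHermiteFn (2 * ℓ + 1) 0 / evenHermiteFn 1 0 *
        (∑ k ∈ Finset.range (1 + 1), (-1 : ℝ) ^ (1 - k) *
          ((2 : ℝ) ^ (1 / 4 : ℝ) * 2 ^ (3 * k) / 2 ^ 1) * Real.sqrt ((2 * 1)! : ℝ) /
          (((2 * k)! : ℝ) * ((1 - k)! : ℝ)) * π ^ k * x ^ (2 * k)) with hw
  have hwg : Function.HasTemperateGrowth w := by
    rw [hw]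
    fun_prop
  refine ⟨SchwartzMap.smulLeftCLM ℝ w (Literature.Analysis.FunctionSpaces.realGaussianSchwartz ℝ π), ?_⟩
  funext x
  rw [SchwartzMap.smulLeftCLM_apply_apply hwg,
    Literature.Analysis.FunctionSpaces.realGaussianSchwartz_apply Real.pi_pos, Real.norm_eq_abs, sq_abs,
    smul_eq_mul, psiMinus, evenHermiteFn_eq_sum_mul (2 * ℓ + 1) x, evenHermiteFn_eq_sum_mul 1 x]
  simp only [hw]
  ring

/-- `∫₀^∞ ψ⁺_ℓ = 0` (i.e. `ψ̂⁺_ℓ(0) = 0`, the second condition of `𝒮(ℝ)₀^{ev}`), from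
`𝒰(ψ⁺_ℓ)(i/2) = 0`. [cite: ConnesConsaniMoscovici2024, §3.6 p. 14 (p0010:L25); Lemma 3.3 proof p. 15 (p0010:L83)] -/
theorem integral_Ioi_psiPlus (ℓ : ℕ) : ∫ t in Ioi (0 : ℝ), psiPlus ℓ t = 0 := by
  have hI : -1 / 2 < (I / 2).im := by simp; norm_num
  have hsq : ((Real.sqrt π : ℝ) : ℂ) ≠ 0 := ofReal_ne_zero.mpr (Real.sqrt_pos.mpr Real.pi_pos).ne'
  have h0 := mulHaarFourier_wInfty_psiPlus ℓ (I / 2) hI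
  rw [polyPplus_eval_I_half, mul_zero, mulHaarFourier_wInfty, transformU, mul_eq_zero,
    mul_eq_zero] at h0
  have hm : mellin (toC (psiPlus ℓ)) (1 / 2 - I * (I / 2)) = 0 := by
    rcases h0 with h | h | h
    · exact absurd h hsq
    · exact absurd h (inv_ne_zero hsq)
    · exact h
  have h1 : (1 / 2 : ℂ) - I * (I / 2) = 1 := by
    rw [show I * (I / 2) = I * I / 2 by ring, I_mul_I]; norm_num
  rw [h1, mellin] at hm
  have hm' : ∫ t in Ioi (0 : ℝ), ((psiPlus ℓ t : ℝ) : ℂ) = 0 := by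
    rw [← hm]
    refine setIntegral_congr_fun measurableSet_Ioi fun t _ => ?_
    simp [toC]
  rw [integral_complex_ofReal] at hm'
  exact_mod_cast hm'

/-- `∫₀^∞ ψ⁻_ℓ = 0`. [cite: ConnesConsaniMoscovici2024, §3.6 p. 14 (p0010:L28); Lemma 3.3 proof p. 15 (p0010:L83)] -/
theorem integral_Ioi_psiMinus (ℓ : ℕ) : ∫ t in Ioi (0 : ℝ), psiMinus ℓ t = 0 := by
  have hI : -1 / 2 < (I / 2).im := by simp; norm_num
  have hsq : ((Real.sqrt π : ℝ) : ℂ) ≠ 0 := ofReal_ne_zero.mpr (Real.sqrt_pos.mpr Real.pi_pos).ne'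
  have h0 := mulHaarFourier_wInfty_psiMinus ℓ (I / 2) hI
  rw [polyPminus_eval_I_half, mul_zero, mulHaarFourier_wInfty, transformU, mul_eq_zero,
    mul_eq_zero] at h0
  have hm : mellin (toC (psiMinus ℓ)) (1 / 2 - I * (I / 2)) = 0 := by
    rcases h0 with h | h | h
    · exact absurd h hsq
    · exact absurd h (inv_ne_zero hsq)
    · exact h
  have h1 : (1 / 2 : ℂ) - I * (I / 2) = 1 := by
    rw [show I * (I / 2) = I * I / 2 by ring, I_mul_I]; norm_num
  rw [h1, mellin] at hm
  have hm' : ∫ t in Ioi (0 : ℝ), ((psiMinus ℓ t : ℝ) : ℂ) = 0 := by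
    rw [← hm]
    refine setIntegral_congr_fun measurableSet_Ioi fun t _ => ?_
    simp [toC]
  rw [integral_complex_ofReal] at hm'
  exact_mod_cast hm'

/-- `ξ` bookkeeping: `ζ(w)·L_∞(w)·(−½(¼ + s²)) = Ξ(s)` at `w = ½ − is`, `w ≠ 0, 1`.
[cite: ConnesConsaniMoscovici2024, §3.6 eq. (35) p. 14 (p0010:L89)] -/
theorem zeta_mul_Gammaℝ_eq_riemannXiUpper {s : ℂ} (hs : -1 / 2 < s.im) (hs' : s ≠ I / 2) :
    riemannZeta (1 / 2 - I * s) * Gammaℝ (1 / 2 - I * s) * (-(1 / 2 : ℂ) * (1 / 4 + s ^ 2)) =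
      riemannXiUpper s := by
  have hw0 : (1 / 2 : ℂ) - I * s ≠ 0 := by
    intro h
    have := congrArg Complex.re h
    simp at this
    linarith
  have hw1 : (1 / 2 : ℂ) - I * s ≠ 1 := by
    intro h
    apply hs'
    have h2 : I * s = -(1 / 2) := by linear_combination -h
    have h3 : s = -I * (I * s) := by rw [← mul_assoc, neg_mul, I_mul_I]; ring
    rw [h3, h2]
    ring
  have hG : Gammaℝ (1 / 2 - I * s) ≠ 0 :=
    Gammaℝ_ne_zero_of_re_pos (by rw [re_w']; linarith)
  rw [riemannXiUpper, show (1 / 2 : ℂ) + I * s = 1 - (1 / 2 - I * s) by ring, riemannXi_one_sub,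
    riemannXi_eq_mul_completedRiemannZeta hw0 hw1, riemannZeta_def_of_ne_zero hw0,
    div_mul_cancel₀ _ hG]
  ring_nf
  rw [I_sq]
  ring

/-- **Proposition 3.6 (i) on `Im s > −1/2`, `s ≠ i/2`, PROVED**: `𝔽_μ(ℰψ⁺_ℓ)(s) = R⁺_ℓ(s)·Ξ(s)`
(Müntz's formula in the critical strip `mellin_connesE_schwartz`, Lemma 3.3 (i), eq. (35)).  The fact
`CCM2024_prop_3_6_i` states this for all `s ∈ ℂ` (entire continuation), which is not proved here.
[cite: ConnesConsaniMoscovici2024, Prop. 3.6 (i) p. 15 (p0011:L6)] -/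
theorem mulHaarFourier_connesE_psiPlus (ℓ : ℕ) {s : ℂ} (hs : -1 / 2 < s.im) (hs' : s ≠ I / 2) :
    mulHaarFourier (toC (connesE (psiPlus ℓ))) s = (polyRplus ℓ).eval s * riemannXiUpper s := by
  obtain ⟨f, hf⟩ := exists_schwartz_coe_eq_psiPlus ℓ
  have hint : ∫ t in Ioi (0 : ℝ), f t = 0 := by rw [hf]; exact integral_Ioi_psiPlus ℓ
  have hre : -(1 / 2 : ℝ) < (-(I * s)).re := by simp; linarith
  have hne : -(I * s) ≠ 1 / 2 := by
    intro h
    apply hs'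
    have h3 : s = -I * (I * s) := by rw [← mul_assoc, neg_mul, I_mul_I]; ring
    rw [h3, show I * s = -(1 / 2) by linear_combination -h]
    ring
  have hM := (mellin_connesE_schwartz f hint hre hne).2
  rw [hf] at hM
  have hw : -(I * s) + 1 / 2 = 1 / 2 - I * s := by ring
  rw [hw] at hM
  -- `mellin ψ⁺ (½ − is) = L_∞(½ − is)·P⁺(s)` (Lemma 3.3 (i))
  have hL : mellin (fun x : ℝ => ((psiPlus ℓ x : ℝ) : ℂ)) (1 / 2 - I * s) =
      Gammaℝ (1 / 2 - I * s) * (polyPplus ℓ).eval s := by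
    have h := mulHaarFourier_wInfty_psiPlus ℓ s hs
    have hsq : ((Real.sqrt π : ℝ) : ℂ) ≠ 0 := ofReal_ne_zero.mpr (Real.sqrt_pos.mpr Real.pi_pos).ne'
    rw [mulHaarFourier_wInfty, transformU, ← mul_assoc, mul_inv_cancel₀ hsq, one_mul] at h
    exact h
  have hP : (polyPplus ℓ).eval s = -(1 / 2 : ℂ) * (1 / 4 + s ^ 2) * (polyRplus ℓ).eval s := by
    have h := congrArg (Polynomial.eval s) (eq_neg_half_mul_of_dvd (quarter_dvd_polyPplus ℓ))
    rw [h, polyRplus]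
    simp only [eval_mul, eval_C, eval_add, eval_pow, eval_X]
  unfold mulHaarFourier toC
  rw [hM, hL, hP, ← zeta_mul_Gammaℝ_eq_riemannXiUpper hs hs']
  ring

/-- **Proposition 3.6 (i) on `Im s > −1/2`, `s ≠ i/2`, PROVED**: `𝔽_μ(ℰψ⁻_ℓ)(s) = R⁻_ℓ(s)·Ξ(s)`.
[cite: ConnesConsaniMoscovici2024, Prop. 3.6 (i) p. 15 (p0011:L6)] -/
theorem mulHaarFourier_connesE_psiMinus (ℓ : ℕ) {s : ℂ} (hs : -1 / 2 < s.im) (hs' : s ≠ I / 2) :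
    mulHaarFourier (toC (connesE (psiMinus ℓ))) s = (polyRminus ℓ).eval s * riemannXiUpper s := by
  obtain ⟨f, hf⟩ := exists_schwartz_coe_eq_psiMinus ℓ
  have hint : ∫ t in Ioi (0 : ℝ), f t = 0 := by rw [hf]; exact integral_Ioi_psiMinus ℓ
  have hre : -(1 / 2 : ℝ) < (-(I * s)).re := by simp; linarith
  have hne : -(I * s) ≠ 1 / 2 := by
    intro h
    apply hs'
    have h3 : s = -I * (I * s) := by rw [← mul_assoc, neg_mul, I_mul_I]; ring
    rw [h3, show I * s = -(1 / 2) by linear_combination -h]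
    ring
  have hM := (mellin_connesE_schwartz f hint hre hne).2
  rw [hf] at hM
  have hw : -(I * s) + 1 / 2 = 1 / 2 - I * s := by ring
  rw [hw] at hM
  have hL : mellin (fun x : ℝ => ((psiMinus ℓ x : ℝ) : ℂ)) (1 / 2 - I * s) =
      Gammaℝ (1 / 2 - I * s) * (polyPminus ℓ).eval s := by
    have h := mulHaarFourier_wInfty_psiMinus ℓ s hs
    have hsq : ((Real.sqrt π : ℝ) : ℂ) ≠ 0 := ofReal_ne_zero.mpr (Real.sqrt_pos.mpr Real.pi_pos).ne'
    rw [mulHaarFourier_wInfty, transformU, ← mul_assoc, mul_inv_cancel₀ hsq, one_mul] at h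
    exact h
  have hP : (polyPminus ℓ).eval s = -(1 / 2 : ℂ) * (1 / 4 + s ^ 2) * (polyRminus ℓ).eval s := by
    have h := congrArg (Polynomial.eval s) (eq_neg_half_mul_of_dvd (quarter_dvd_polyPminus ℓ))
    rw [h, polyRminus]
    simp only [eval_mul, eval_C, eval_add, eval_pow, eval_X]
  unfold mulHaarFourier toC
  rw [hM, hL, hP, ← zeta_mul_Gammaℝ_eq_riemannXiUpper hs hs']
  ring

/-! ### Schwartz bookkeeping -/

/-- Polynomial decay of a Schwartz function: `|x|^k ‖g x‖ ≤ C`. [folklore] -/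
private theorem schwartz_pow_mul_norm_le (g : SchwartzMap ℝ ℂ) (k : ℕ) :
    ∃ C : ℝ, 0 < C ∧ ∀ x : ℝ, |x| ^ k * ‖g x‖ ≤ C := by
  obtain ⟨C, hC, h⟩ := g.decay k 0
  refine ⟨C, hC, fun x => ?_⟩
  have := h x
  rwa [norm_iteratedFDeriv_zero, Real.norm_eq_abs] at this

/-- Decay in the form `‖g y‖ ≤ C / |y|^k` for `y ≠ 0`. [folklore] -/
private theorem schwartz_norm_le_div (g : SchwartzMap ℝ ℂ) (k : ℕ) :
    ∃ C : ℝ, 0 < C ∧ ∀ y : ℝ, y ≠ 0 → ‖g y‖ ≤ C / |y| ^ k := by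
  obtain ⟨C, hC, h⟩ := schwartz_pow_mul_norm_le g k
  refine ⟨C, hC, fun y hy => ?_⟩
  have hpos : 0 < |y| ^ k := pow_pos (abs_pos.mpr hy) k
  rw [le_div_iff₀ hpos, mul_comm]
  exact h y

/-- The Fourier transform of a dilation: `𝓕(x ↦ g(xu))(ξ) = u⁻¹ 𝓕g(ξ/u)` (`u > 0`). [folklore] -/
private theorem fourier_comp_mul_right (g : ℝ → ℂ) {u : ℝ} (hu : 0 < u) (ξ : ℝ) :
    𝓕 (fun x : ℝ => g (x * u)) ξ = (u⁻¹ : ℂ) * 𝓕 g (ξ / u) := by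
  rw [Real.fourier_real_eq, Real.fourier_real_eq]
  have h : (fun v : ℝ => 𝐞 (-(v * ξ)) • g (v * u)) =
      fun v : ℝ => (fun y : ℝ => 𝐞 (-(y * (ξ / u))) • g y) (v * u) := by
    funext v
    simp only
    congr 2
    field_simp
  rw [h, Measure.integral_comp_mul_right (fun y : ℝ => 𝐞 (-(y * (ξ / u))) • g y) u,
    abs_of_pos (inv_pos.mpr hu), Complex.real_smul]
  push_cast
  ring

/-- `𝓕 g(0) = ∫ g`. [folklore] -/
private theorem fourier_apply_zero (g : ℝ → ℂ) : 𝓕 g 0 = ∫ x : ℝ, g x := by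
  rw [Real.fourier_real_eq]
  simp

/-- For an even integrable real function with `∫₀^∞ f = 0`, `∫_ℝ f = 0`. [folklore] -/
private theorem integral_eq_zero_of_even_of_Ioi {f : ℝ → ℝ} (hf : Integrable f)
    (heven : ∀ x, f (-x) = f x) (h : ∫ x in Ioi 0, f x = 0) : ∫ x, f x = 0 := by
  have h1 : ∫ x in Iic (0 : ℝ), f x = ∫ x in Ioi 0, f x := by
    have h2 : ∫ x in Iic (0 : ℝ), f (-x) = ∫ x in Ioi (-0 : ℝ), f x := integral_comp_neg_Iic 0 f
    simp only [heven, neg_zero] at h2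
    exact h2
  have h3 := intervalIntegral.integral_Iic_add_Ioi (μ := volume) (f := f) (b := 0)
    hf.integrableOn hf.integrableOn
  rw [← h3, h1, h, add_zero]

/-! ### The Poisson step: `Σ_{n≥1} f(nu) = u⁻¹ Σ_{k≥1} (f̂(k/u) + f̂(−k/u))/2` -/

/-- Splitting an even-indexed `ℤ`-sum. [folklore] -/
private theorem tsum_int_eq {h : ℤ → ℂ} (hs : Summable h) :
    ∑' n : ℤ, h n = h 0 + ∑' n : ℕ, (h ((n : ℤ) + 1) + h (-((n : ℤ) + 1))) := by
  have h1 := hs.hasSum.nat_add_neg_add_one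
  -- `Σ_{n:ℕ} (h n + h(−(n+1))) = Σ_ℤ h`
  have hsN : Summable fun n : ℕ => h n := hs.comp_injective Nat.cast_injective
  have hsM : Summable fun n : ℕ => h (-((n : ℤ) + 1)) := by
    have : Summable fun n : ℕ => h n + h (-((n : ℤ) + 1)) := h1.summable
    simpa using this.sub hsN  -- (h n + h(-(n+1))) - h n
  rw [← h1.tsum_eq, hsN.tsum_add hsM, hsN.tsum_eq_zero_add]
  have hs1 : Summable fun n : ℕ => h ((n : ℤ) + 1) := by
    have := (summable_nat_add_iff 1).mpr hsN
    simpa [Nat.cast_add, Nat.cast_one] using this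
  rw [hs1.tsum_add hsM]
  push_cast
  ring


/-- Summability over `ℤ` of a Schwartz function sampled at the integers. [folklore] -/
private theorem summable_int_schwartz (G : SchwartzMap ℝ ℂ) : Summable fun n : ℤ => G n :=
  summable_of_isBigO (Real.summable_abs_int_rpow one_lt_two)
    ((G.isBigO_cocompact_rpow (-2)).comp_tendsto Int.tendsto_coe_cofinite)

/-- **Poisson summation for dilates** of an even Schwartz `F` with `F(0) = 0`, `∫F = 0`:
`2 Σ_{n≥1} F(nu) = u⁻¹ Σ_{k≥1} (F̂(k/u) + F̂(−k/u))` (`u > 0`). [folklore] -/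
private theorem two_mul_tsum_dilate_eq (F : SchwartzMap ℝ ℂ) (heven : ∀ x, F (-x) = F x)
    (h0 : F 0 = 0) (hint : ∫ x : ℝ, F x = 0) {u : ℝ} (hu : 0 < u) :
    2 * ∑' n : ℕ, F (((n + 1 : ℕ) : ℝ) * u) =
      (u⁻¹ : ℂ) * ∑' k : ℕ, (𝓕 (⇑F) (((k + 1 : ℕ) : ℝ) / u) + 𝓕 (⇑F) (-((k + 1 : ℕ) : ℝ) / u)) := by
  set g : ℝ ≃L[ℝ] ℝ := ContinuousLinearEquiv.unitsEquivAut ℝ (Units.mk0 u hu.ne') with hg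
  set Fu : SchwartzMap ℝ ℂ := SchwartzMap.compCLMOfContinuousLinearEquiv ℂ g F with hFu
  have hFu_apply : ∀ x : ℝ, Fu x = F (x * u) := fun x => by
    simp [hFu, hg, ContinuousLinearEquiv.unitsEquivAut_apply]
  have hFu_coe : (⇑Fu : ℝ → ℂ) = fun x => F (x * u) := funext hFu_apply
  have hP := Fu.tsum_eq_tsum_fourier 0
  simp only [zero_add, QuotientAddGroup.mk_zero, fourier_eval_zero, mul_one] at hP
  have hFT : ∀ ξ : ℝ, 𝓕 (⇑Fu) ξ = (u⁻¹ : ℂ) * 𝓕 (⇑F) (ξ / u) := fun ξ => by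
    rw [hFu_coe, fourier_comp_mul_right _ hu]
  have hs1 : Summable fun n : ℤ => Fu n := summable_int_schwartz Fu
  have hs2 : Summable fun n : ℤ => 𝓕 (⇑Fu) n := by
    have := summable_int_schwartz (𝓕 Fu)
    simpa [SchwartzMap.fourier_coe] using this
  rw [SchwartzMap.fourier_coe, tsum_int_eq hs1, tsum_int_eq hs2] at hP
  have hF0 : 𝓕 (⇑F) 0 = 0 := by rw [fourier_apply_zero, hint]
  simp only [hFu_apply, hFT, Int.cast_zero, zero_mul, h0, zero_div, hF0, mul_zero, zero_add,
    Int.cast_neg, Int.cast_add, Int.cast_natCast, Int.cast_one, neg_mul, heven] at hP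
  simp_rw [← two_mul, ← mul_add] at hP
  rw [tsum_mul_left, tsum_mul_left] at hP
  push_cast
  exact hP


/-- `Σ_{k≥1} k^{−M}` converges for `M ≥ 2`. [folklore] -/
private theorem summable_one_div_succ_pow {M : ℕ} (hM : 2 ≤ M) :
    Summable fun k : ℕ => 1 / ((k + 1 : ℕ) : ℝ) ^ M := by
  have := (summable_nat_add_iff 1).mpr (Real.summable_one_div_nat_pow.mpr (by omega : 1 < M))
  simpa using this

/-- **Rapid decay of `Σ_{n≥1} F(nu)` at `u → 0⁺`** for even Schwartz `F` with `F(0) = ∫F = 0`: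
`‖Σ_{n≥1} F(nu)‖ ≤ C·u^{M−1}` for all `u > 0` (any `M ≥ 2`). [folklore] -/
private theorem norm_tsum_dilate_le_pow (F : SchwartzMap ℝ ℂ) (heven : ∀ x, F (-x) = F x)
    (h0 : F 0 = 0) (hint : ∫ x : ℝ, F x = 0) {M : ℕ} (hM : 2 ≤ M) :
    ∃ C : ℝ, ∀ u : ℝ, 0 < u → ‖∑' n : ℕ, F (((n + 1 : ℕ) : ℝ) * u)‖ ≤ C * u ^ (M - 1) := by
  obtain ⟨D, hD, hdec⟩ := schwartz_norm_le_div (𝓕 F) M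
  set Z : ℝ := ∑' k : ℕ, 1 / ((k + 1 : ℕ) : ℝ) ^ M with hZ
  refine ⟨D * Z, fun u hu => ?_⟩
  have h2 := two_mul_tsum_dilate_eq F heven h0 hint hu
  set T := ∑' k : ℕ, (𝓕 (⇑F) (((k + 1 : ℕ) : ℝ) / u) + 𝓕 (⇑F) (-((k + 1 : ℕ) : ℝ) / u)) with hT
  have hTle : ‖T‖ ≤ 2 * D * u ^ M * Z := by
    have hg : HasSum (fun k : ℕ => 2 * D * u ^ M * (1 / ((k + 1 : ℕ) : ℝ) ^ M)) (2 * D * u ^ M * Z) :=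
      (summable_one_div_succ_pow hM).hasSum.mul_left _
    refine tsum_of_norm_bounded hg fun k => ?_
    have hk : (0 : ℝ) < ((k + 1 : ℕ) : ℝ) := by positivity
    have hy1 : ((k + 1 : ℕ) : ℝ) / u ≠ 0 := (div_pos hk hu).ne'
    have hy2 : -((k + 1 : ℕ) : ℝ) / u ≠ 0 := by rw [neg_div]; exact neg_ne_zero.mpr hy1
    have e1 := hdec _ hy1
    have e2 := hdec _ hy2
    rw [SchwartzMap.fourier_coe] at e1 e2
    rw [abs_of_pos (div_pos hk hu), div_pow] at e1
    rw [neg_div, abs_neg, abs_of_pos (div_pos hk hu), div_pow] at e2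
    have hkM : (0 : ℝ) < ((k + 1 : ℕ) : ℝ) ^ M := pow_pos hk M
    have huM : (0 : ℝ) < u ^ M := pow_pos hu M
    calc ‖𝓕 (⇑F) (((k + 1 : ℕ) : ℝ) / u) + 𝓕 (⇑F) (-((k + 1 : ℕ) : ℝ) / u)‖
        ≤ ‖𝓕 (⇑F) (((k + 1 : ℕ) : ℝ) / u)‖ + ‖𝓕 (⇑F) (-((k + 1 : ℕ) : ℝ) / u)‖ := norm_add_le _ _
      _ ≤ D / (((k + 1 : ℕ) : ℝ) ^ M / u ^ M) + D / (((k + 1 : ℕ) : ℝ) ^ M / u ^ M) := by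
          rw [neg_div]; exact add_le_add e1 e2
      _ = 2 * D * u ^ M * (1 / ((k + 1 : ℕ) : ℝ) ^ M) := by
          field_simp
          norm_num
  have hS : ∑' n : ℕ, F (((n + 1 : ℕ) : ℝ) * u) = (1 / 2 : ℂ) * (u⁻¹ : ℂ) * T := by
    linear_combination (1 / 2 : ℂ) * h2
  have hM1 : u ^ M = u ^ (M - 1) * u := by
    rw [← pow_succ, Nat.sub_add_cancel (by omega : 1 ≤ M)]
  rw [hS, norm_mul, norm_mul, norm_inv, Complex.norm_real, Real.norm_of_nonneg hu.le]
  have h12 : ‖(1 / 2 : ℂ)‖ = 1 / 2 := by simp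
  rw [h12]
  calc 1 / 2 * u⁻¹ * ‖T‖ ≤ 1 / 2 * u⁻¹ * (2 * D * u ^ M * Z) := by gcongr
    _ = D * Z * u ^ (M - 1) := by rw [hM1]; field_simp

/-- **Rapid decay of `Σ_{n≥1} F(nu)` at `u → ∞`**: `‖Σ_{n≥1} F(nu)‖ ≤ C/u^M` for all `u > 0`
(any `M ≥ 2`, any Schwartz `F`). [folklore] -/
private theorem norm_tsum_dilate_le_inv_pow (F : SchwartzMap ℝ ℂ) {M : ℕ} (hM : 2 ≤ M) :
    ∃ C : ℝ, ∀ u : ℝ, 0 < u → ‖∑' n : ℕ, F (((n + 1 : ℕ) : ℝ) * u)‖ ≤ C / u ^ M := by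
  obtain ⟨D, hD, hdec⟩ := schwartz_norm_le_div F M
  set Z : ℝ := ∑' k : ℕ, 1 / ((k + 1 : ℕ) : ℝ) ^ M with hZ
  refine ⟨D * Z, fun u hu => ?_⟩
  have hg : HasSum (fun n : ℕ => D / u ^ M * (1 / ((n + 1 : ℕ) : ℝ) ^ M)) (D / u ^ M * Z) :=
    (summable_one_div_succ_pow hM).hasSum.mul_left _
  have h := tsum_of_norm_bounded (f := fun n : ℕ => F (((n + 1 : ℕ) : ℝ) * u)) hg fun n => ?_
  · calc ‖∑' n : ℕ, F (((n + 1 : ℕ) : ℝ) * u)‖ ≤ D / u ^ M * Z := h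
      _ = D * Z / u ^ M := by ring
  · have hn : (0 : ℝ) < ((n + 1 : ℕ) : ℝ) := by positivity
    have hy : ((n + 1 : ℕ) : ℝ) * u ≠ 0 := (mul_pos hn hu).ne'
    have e := hdec _ hy
    rw [abs_of_pos (mul_pos hn hu), mul_pow] at e
    have hkM : (0 : ℝ) < ((n + 1 : ℕ) : ℝ) ^ M := pow_pos hn M
    have huM : (0 : ℝ) < u ^ M := pow_pos hu M
    calc ‖F (((n + 1 : ℕ) : ℝ) * u)‖ ≤ D / (((n + 1 : ℕ) : ℝ) ^ M * u ^ M) := e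
      _ = D / u ^ M * (1 / ((n + 1 : ℕ) : ℝ) ^ M) := by field_simp

/-! ### The real-valued layer: `𝓔(f)` for `f ∈ 𝒮(ℝ)₀^{ev}` -/

/-- `𝓔(f)(u) = O(u^{−b})` as `u → 0⁺` for every `b` (rapid decay at `0`), for even real Schwartz `f`
with `f(0) = 0` and `∫₀^∞ f = 0` (Poisson summation) — the mechanism by which `ℰ` acts on `𝒮(ℝ)₀^{ev}` in §3.6.
[cite: ConnesConsaniMoscovici2024, §3.6 p. 14 (p0010:L22–L28)] -/
theorem connesE_schwartz_isBigO_nhdsGT_zero (f : SchwartzMap ℝ ℝ) (heven : ∀ x, f (-x) = f x)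
    (h0 : f 0 = 0) (hint : ∫ x in Ioi (0 : ℝ), f x = 0) (b : ℝ) :
    (fun u : ℝ => (connesE f u : ℂ)) =O[𝓝[>] (0 : ℝ)] fun u : ℝ => u ^ (-b) := by
  set F : SchwartzMap ℝ ℂ := SchwartzMap.postcompCLM Complex.ofRealCLM f with hF
  have hFx : ∀ x, F x = ((f x : ℝ) : ℂ) := fun x => rfl
  have hFeven : ∀ x, F (-x) = F x := fun x => by rw [hFx, hFx, heven]
  have hF0 : F 0 = 0 := by rw [hFx, h0]; simp
  have hFint : ∫ x : ℝ, F x = 0 := by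
    simp only [hFx, integral_complex_ofReal]
    rw [integral_eq_zero_of_even_of_Ioi f.integrable heven hint]
    simp
  set M : ℕ := ⌈|b|⌉₊ + 2 with hMdef
  have hM : 2 ≤ M := by omega
  obtain ⟨C, hC⟩ := norm_tsum_dilate_le_pow F hFeven hF0 hFint hM
  have hexp : -b ≤ ((M - 1 : ℕ) : ℝ) + 1 / 2 := by
    have h1 : (|b| : ℝ) ≤ ⌈|b|⌉₊ := Nat.le_ceil _
    have h2 : ((M - 1 : ℕ) : ℝ) = ⌈|b|⌉₊ + 1 := by
      rw [hMdef, Nat.add_sub_assoc (by norm_num : 1 ≤ 2)]; push_cast; ring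
    rw [h2]
    linarith [neg_abs_le b]
  refine IsBigO.of_bound |C| ?_
  filter_upwards [Ioo_mem_nhdsGT (zero_lt_one' ℝ)] with u hu
  have hu0 : 0 < u := hu.1
  have htsum : ((∑' n : ℕ, f (((n + 1 : ℕ) : ℝ) * u) : ℝ) : ℂ) = ∑' n : ℕ, F (((n + 1 : ℕ) : ℝ) * u) := by
    rw [Complex.ofReal_tsum]
    exact tsum_congr fun n => rfl
  have habs : |∑' n : ℕ, f (((n + 1 : ℕ) : ℝ) * u)| = ‖∑' n : ℕ, F (((n + 1 : ℕ) : ℝ) * u)‖ := by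
    rw [← htsum, Complex.norm_real, Real.norm_eq_abs]
  rw [Complex.norm_real, Real.norm_eq_abs, connesE, abs_mul, abs_of_nonneg (Real.sqrt_nonneg _),
    Real.norm_of_nonneg (Real.rpow_nonneg hu0.le _), habs]
  calc Real.sqrt u * ‖∑' n : ℕ, F (((n + 1 : ℕ) : ℝ) * u)‖ ≤ Real.sqrt u * (C * u ^ (M - 1)) := by
        gcongr; exact hC u hu0
    _ ≤ Real.sqrt u * (|C| * u ^ (M - 1)) := by gcongr; exact le_abs_self C
    _ = |C| * u ^ (((M - 1 : ℕ) : ℝ) + 1 / 2) := by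
        rw [Real.rpow_add hu0, Real.rpow_natCast, Real.sqrt_eq_rpow]; ring
    _ ≤ |C| * u ^ (-b) :=
        mul_le_mul_of_nonneg_left (Real.rpow_le_rpow_of_exponent_ge hu0 hu.2.le hexp) (abs_nonneg C)

/-- `𝓔(f)(u) = O(u^{−a})` as `u → ∞` for every `a`, for any real Schwartz `f` (rapid decay of `ℰf` at `∞`,
§3.6). [cite: ConnesConsaniMoscovici2024, §3.6 p. 14 (p0010:L22)] -/
theorem connesE_schwartz_isBigO_atTop (f : SchwartzMap ℝ ℝ) (a : ℝ) :
    (fun u : ℝ => (connesE f u : ℂ)) =O[atTop] fun u : ℝ => u ^ (-a) := by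
  set F : SchwartzMap ℝ ℂ := SchwartzMap.postcompCLM Complex.ofRealCLM f with hF
  have hFx : ∀ x, F x = ((f x : ℝ) : ℂ) := fun x => rfl
  set M : ℕ := ⌈|a|⌉₊ + 2 with hMdef
  have hM : 2 ≤ M := by omega
  obtain ⟨C, hC⟩ := norm_tsum_dilate_le_inv_pow F hM
  have hexp : (1 / 2 : ℝ) - M ≤ -a := by
    have h1 : (|a| : ℝ) ≤ ⌈|a|⌉₊ := Nat.le_ceil _
    have h2 : (M : ℝ) = ⌈|a|⌉₊ + 2 := by rw [hMdef]; push_cast; ring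
    rw [h2]
    linarith [le_abs_self a]
  refine IsBigO.of_bound |C| ?_
  filter_upwards [eventually_ge_atTop (1 : ℝ)] with u hu
  have hu0 : 0 < u := by linarith
  have htsum : ((∑' n : ℕ, f (((n + 1 : ℕ) : ℝ) * u) : ℝ) : ℂ) = ∑' n : ℕ, F (((n + 1 : ℕ) : ℝ) * u) := by
    rw [Complex.ofReal_tsum]
    exact tsum_congr fun n => rfl
  have habs : |∑' n : ℕ, f (((n + 1 : ℕ) : ℝ) * u)| = ‖∑' n : ℕ, F (((n + 1 : ℕ) : ℝ) * u)‖ := by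
    rw [← htsum, Complex.norm_real, Real.norm_eq_abs]
  rw [Complex.norm_real, Real.norm_eq_abs, connesE, abs_mul, abs_of_nonneg (Real.sqrt_nonneg _),
    Real.norm_of_nonneg (Real.rpow_nonneg hu0.le _), habs]
  calc Real.sqrt u * ‖∑' n : ℕ, F (((n + 1 : ℕ) : ℝ) * u)‖ ≤ Real.sqrt u * (C / u ^ M) := by
        gcongr; exact hC u hu0
    _ ≤ Real.sqrt u * (|C| / u ^ M) := by gcongr; exact le_abs_self C
    _ = |C| * u ^ ((1 / 2 : ℝ) - M) := by
        rw [Real.rpow_sub hu0, Real.rpow_natCast, Real.sqrt_eq_rpow]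
        ring
    _ ≤ |C| * u ^ (-a) :=
        mul_le_mul_of_nonneg_left (Real.rpow_le_rpow_of_exponent_le hu hexp) (abs_nonneg C)

/-- **`𝓔` maps `𝒮(ℝ)₀^{ev}` to functions with ENTIRE Mellin transform**: for an even real Schwartz
`f` with `f(0) = 0` and `∫₀^∞ f = 0`, `s ↦ ∫₀^∞ 𝓔(f)(u) u^{s−1} du` is differentiable on all of `ℂ`.
[cite: ConnesConsaniMoscovici2024, §3.6 p. 14–15 (p0010:L22, p0011:L6)] -/
theorem differentiable_mellin_connesE (f : SchwartzMap ℝ ℝ) (heven : ∀ x, f (-x) = f x)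
    (h0 : f 0 = 0) (hint : ∫ x in Ioi (0 : ℝ), f x = 0) :
    Differentiable ℂ (mellin fun u : ℝ => (connesE f u : ℂ)) := by
  intro z
  have hconv := (mellin_connesE_schwartz f hint (s := 1) (by norm_num) (by norm_num)).1
  have hloc : LocallyIntegrableOn (fun u : ℝ => (connesE f u : ℂ)) (Ioi 0) := by
    have h1 : IntegrableOn (fun u : ℝ => (connesE f u : ℂ)) (Ioi 0) := by
      refine (integrableOn_congr_fun (fun t (ht : t ∈ Ioi (0:ℝ)) => ?_) measurableSet_Ioi).mp hconv
      simp
    exact h1.locallyIntegrableOn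
  exact mellin_differentiableAt_of_isBigO_rpow hloc (connesE_schwartz_isBigO_atTop f (z.re + 1)) (by linarith)
    (connesE_schwartz_isBigO_nhdsGT_zero f heven h0 hint (z.re - 1)) (by linarith)


/-! ### Proposition 3.6 (i) on all of `ℂ` (analytic continuation) -/

/-- `h_{2n}` is even. [cite: ConnesConsaniMoscovici2024, Prop. 3.2 eq. (21) p. 11 (p0009:L5)] -/
theorem evenHermiteFn_neg (n : ℕ) (x : ℝ) : evenHermiteFn n (-x) = evenHermiteFn n x := by
  simp only [evenHermiteFn, neg_sq, (even_two_mul _).neg_pow]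

/-- `ψ⁺_ℓ` is even. [cite: ConnesConsaniMoscovici2024, §3.6 eq. (29) p. 14 (p0010:L25)] -/
theorem psiPlus_neg (ℓ : ℕ) (x : ℝ) : psiPlus ℓ (-x) = psiPlus ℓ x := by
  simp only [psiPlus, evenHermiteFn_neg, hermiteH0, neg_sq]

/-- `ψ⁻_ℓ` is even. [cite: ConnesConsaniMoscovici2024, §3.6 eq. (29) p. 14 (p0010:L28)] -/
theorem psiMinus_neg (ℓ : ℕ) (x : ℝ) : psiMinus ℓ (-x) = psiMinus ℓ x := by
  simp only [psiMinus, evenHermiteFn_neg]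

/-- Identity theorem on the region `{Im s > −1/2, s ≠ i/2}`: two entire functions agreeing there agree
everywhere. [folklore] -/
private theorem eq_of_eq_on_halfplane {L R : ℂ → ℂ} (hL : Differentiable ℂ L) (hR : Differentiable ℂ R)
    (h : ∀ s : ℂ, -1 / 2 < s.im → s ≠ I / 2 → L s = R s) : L = R := by
  refine AnalyticOnNhd.eq_of_eventuallyEq (analyticOnNhd_univ_iff_differentiable.mpr hL)
    (analyticOnNhd_univ_iff_differentiable.mpr hR) (z₀ := 0) ?_
  have hU : {s : ℂ | -1 / 2 < s.im ∧ s ≠ I / 2} ∈ 𝓝 (0 : ℂ) := by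
    refine IsOpen.mem_nhds ((isOpen_lt continuous_const Complex.continuous_im).inter isOpen_ne) ?_
    refine ⟨by simp; norm_num, ?_⟩
    intro h
    have := congrArg Complex.im h
    simp at this
  exact Filter.eventually_of_mem hU fun s hs => h s hs.1 hs.2

/-- `𝔽_μ(ℰψ)` is entire for `ψ` even Schwartz with `ψ(0) = ∫₀^∞ψ = 0`. [cite: ConnesConsaniMoscovici2024, §3.6 p. 14 (p0010:L22)] -/
private theorem differentiable_mulHaarFourier_connesE {ψ : ℝ → ℝ} (f : SchwartzMap ℝ ℝ) (hf : ⇑f = ψ)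
    (heven : ∀ x, ψ (-x) = ψ x) (h0 : ψ 0 = 0) (hint : ∫ t in Ioi (0 : ℝ), ψ t = 0) :
    Differentiable ℂ fun s : ℂ => mulHaarFourier (toC (connesE ψ)) s := by
  have hd := differentiable_mellin_connesE f (fun x => by rw [hf, heven]) (by rw [hf, h0])
    (by rw [hf]; exact hint)
  rw [hf] at hd
  change Differentiable ℂ fun s : ℂ => mellin (fun u : ℝ => (connesE ψ u : ℂ)) (-(I * s))
  exact hd.comp ((differentiable_const I).mul differentiable_id).neg

/-- `s ↦ R(s)·Ξ(s)` is entire. [cite: ConnesConsaniMoscovici2024, §3.6 eq. (35) p. 14 (p0010:L89)] -/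
private theorem differentiable_eval_mul_riemannXiUpper (R : ℂ[X]) :
    Differentiable ℂ fun s : ℂ => R.eval s * riemannXiUpper s := by
  refine R.differentiable.mul ?_
  change Differentiable ℂ fun s : ℂ => riemannXi (1 / 2 + I * s)
  exact differentiable_riemannXi.comp ((differentiable_const _).add ((differentiable_const I).mul differentiable_id))

/-- **Proposition 3.6 (i) DISCHARGED**: `𝔽_μ(ℰ(ψ^±_ℓ))(s) = R^±_ℓ(s)·Ξ(s)` for ALL `s ∈ ℂ` — the identity on
`Im s > −1/2, s ≠ i/2` (Müntz + Lemma 3.3 (i) + eq. (35)) extends by analytic continuation, both sides being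
entire (`𝔽_μ(ℰψ)` entire because `ℰψ` decays rapidly at `0` — Poisson summation with `ψ(0) = ψ̂(0) = 0` — and
at `∞`). [cite: ConnesConsaniMoscovici2024, Prop. 3.6 (i) p. 15 (p0011:L6–L12)] -/
theorem CCM2024_prop_3_6_i_holds : CCM2024_prop_3_6_i := by
  intro ℓ s
  obtain ⟨f₁, hf₁⟩ := exists_schwartz_coe_eq_psiPlus ℓ
  obtain ⟨f₂, hf₂⟩ := exists_schwartz_coe_eq_psiMinus ℓ
  have h1 := eq_of_eq_on_halfplane
    (differentiable_mulHaarFourier_connesE f₁ hf₁ (psiPlus_neg ℓ) (psiPlus_zero ℓ) (integral_Ioi_psiPlus ℓ))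
    (differentiable_eval_mul_riemannXiUpper (polyRplus ℓ))
    (fun s hs hs' => mulHaarFourier_connesE_psiPlus ℓ hs hs')
  have h2 := eq_of_eq_on_halfplane
    (differentiable_mulHaarFourier_connesE f₂ hf₂ (psiMinus_neg ℓ) (psiMinus_zero ℓ) (integral_Ioi_psiMinus ℓ))
    (differentiable_eval_mul_riemannXiUpper (polyRminus ℓ))
    (fun s hs hs' => mulHaarFourier_connesE_psiMinus ℓ hs hs')
  exact ⟨congrFun h1 s, congrFun h2 s⟩

/-! ### Eq. (9) for even cyclic pairs: the discharge one-liner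

`CCM2024_eq_9` (restated for EVEN cyclic pairs, p428964) is, verbatim, seat t16's theorem
`CCM2024_eq_9_of_even` (`ProlateWaveCyclicPairsJacobiProofs.lean`: general three-term recurrence with
diagonal `b_n = ⟨ξ_n | Dξ_n⟩`, and `b_n = 0` from `γ ξ_n = (−1)ⁿ ξ_n`). -/

/-- **Eq. (9) DISCHARGED** (even cyclic pairs; proof = seat t16's `CCM2024_eq_9_of_even`).
[cite: ConnesConsaniMoscovici2024, §2.1 eq. (9) p. 7 (p0006:L38, p0006:L49)] -/
theorem CCM2024_eq_9_holds : CCM2024_eq_9 :=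
  fun D ξ v hD hv => CCM2024_eq_9_of_even D ξ v hD hv

end Literature.NumberTheory.ConnesConsani2024
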